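/-
Copyright (c) 2026. All rights reserved.
Released under Apache 2.0 license as described in the file LICENSE.
-/
import Literature.Geometry.Riemannian.CurvatureAsDivergence
import Literature.Geometry.Riemannian.TransportedCutoff
import Literature.Geometry.Lorentzian.IndexFluxRemainder
import Literature.Geometry.Lorentzian.VolumeChartIntegral
import Literature.Geometry.Lorentzian.WeakSolutionRegularity

/-!
# Gauss–Bonnet, local step: the index flux of the normalized acceleration field

[scope: pseudo-Riemannian/manifold]

This file transports the Euclidean index-flux computation of
`Literature/Geometry/Riemannian/IndexFluxLimit.lean` to a Riemannian surface. For a smooth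
vector field `Y` on a `2`-manifold `N` with a *nondegenerate* zero at `p` (the derivative `L` of
its chart representative at `φ p` is invertible) we build the cutoff
`χ_r = θ(‖T(φ · − φ p)‖² / r²)` (`T = A ∘ L`, `AᵀA` the metric at `p` in the chart), equal to `1`
off a small compact neighbourhood of `p` and to `0` near `p`, and prove

  `|∫_N dχ_r(X) dμ_g + 2π · sign (det L)| ≤ C r`,   `X = (∇_Y Y − (div Y) Y)/g(Y,Y)`

(`mcutoff`, `abs_integral_mvfderiv_mcutoff_add_le`). Summed over the zeros of a gradient-like
field and combined with `div X = scal/2` (`vectorDivergence_normalizedAcceleration`) and the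
divergence theorem, this is the analytic heart of the Poincaré–Hopf proof of the Gauss–Bonnet
theorem (`Literature/Geometry/Riemannian/GaussBonnet.lean`).

## References

* M. P. do Carmo, *Differential geometry of curves and surfaces* (1976), §4-5.
* J. M. Lee, *Introduction to Riemannian Manifolds* (2018), Thm. 9.7. [folklore]
-/

open Bundle Set Metric Filter Function MeasureTheory
open ContMDiffRiemannianMetric Literature.Geometry.Lorentzian
open Literature.Geometry.Lorentzian.MetricCoord Literature.Geometry.Lorentzian.PseudoRiemannianMetric
open Literature.Geometry.Riemannian.IndexFlux
open scoped ContDiff Manifold Topology RealInnerProductSpace Real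

noncomputable section

namespace Literature.Geometry.Riemannian

/-! ### The index flux on a Riemannian surface -/

section Flux

variable {N : Type*} [TopologicalSpace N] [ChartedSpace (EuclideanSpace ℝ (Fin 2)) N]
  [IsManifold (𝓡 2) ∞ N] [T3Space N] [MeasurableSpace N] [BorelSpace N]
  (h : ContMDiffRiemannianMetric (𝓡 2) ∞ (EuclideanSpace ℝ (Fin 2))
    (TangentSpace (𝓡 2) : N → Type _))
  [(ofRiemannian h).HasLeviCivita]

omit [T3Space N] [MeasurableSpace N] [BorelSpace N]
  [(ofRiemannian h).HasLeviCivita] in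
/-- Unfolding of `metricRep` through the trivialization (as in `GaussBonnetGradient.lean`):
`Ĝ_e(v, w) = g(e.symmL v, e.symmL w)` at `φ⁻¹ e`. [folklore] -/
theorem metricRep_apply_eq_val_symmL' (g : PseudoRiemannianMetric (𝓡 2) ∞
    (EuclideanSpace ℝ (Fin 2)) (TangentSpace (𝓡 2) : N → Type _)) (x₀ : N)
    (e v w : EuclideanSpace ℝ (Fin 2)) :
    metricRep (𝓡 2) g x₀ e v w = g.val ((extChartAt (𝓡 2) x₀).symm e)
      ((trivializationAt (EuclideanSpace ℝ (Fin 2)) (TangentSpace (𝓡 2)) x₀).symmL ℝ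
        ((extChartAt (𝓡 2) x₀).symm e) v)
      ((trivializationAt (EuclideanSpace ℝ (Fin 2)) (TangentSpace (𝓡 2)) x₀).symmL ℝ
        ((extChartAt (𝓡 2) x₀).symm e) w) := rfl

set_option backward.isDefEq.respectTransparency false in
set_option maxHeartbeats 800000 in
/-- **The index flux of the normalized acceleration field.** Let `Y` be a smooth vector field on
the Riemannian surface `(N, h)` with a nondegenerate zero at `p`: the derivative at `φ p` of its
chart representative is the invertible map `L`. Let `A` be a chart linearization of the metric at
`p` (`Ĝ_{φ p}(v, w) = ⟪A v, A w⟫`, i.e. `AᵀA = (h_{ij}(φ p))`) and `χ_r` the transported cutoff built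
with `T = A ∘ L`. Then for the field `X = (∇_Y Y − (div Y) Y)/h(Y, Y)`,

  `|∫_N dχ_r(X) dμ_h + 2π · det L / |det L|| ≤ C r`     (`0 < r < r₀`).

In the chart the integral is `∫ Dχ̂_r(Xr) √det(h_{ij}) dx` (`integral_eq_integral_chart`);
`Xr = −det L · (x − c)/‖AL(x − c)‖² + O(1)` (`IsMetricOn.exists_remainder_bound`), the density is
`|det A| + O(‖x − c‖)`, and the Euclidean flux computation `abs_integral_fderiv_cutoff_sub_le`
gives `2π (−det L) |det A| / |det (A L)| = −2π sign (det L)` up to `O(r)`. This is the local index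
computation in the Poincaré–Hopf proof of the Gauss–Bonnet theorem (do Carmo 1976, §4-5;
Lee 2018, Thm. 9.7). [folklore] -/
theorem abs_integral_mvfderiv_mcutoff_add_le (p : N) {Y : Π y : N, TangentSpace (𝓡 2) y}
    (hY : ContMDiff (𝓡 2) ((𝓡 2).prod 𝓘(ℝ, EuclideanSpace ℝ (Fin 2))) ∞ fun y ↦
      (TotalSpace.mk' (EuclideanSpace ℝ (Fin 2)) y (Y y) : TangentBundle (𝓡 2) N))
    (hYp : Y p = 0)
    (L : EuclideanSpace ℝ (Fin 2) ≃L[ℝ] EuclideanSpace ℝ (Fin 2))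
    (hL : fderiv ℝ (vectorRep (𝓡 2) p Y) (extChartAt (𝓡 2) p p) = L)
    (A : EuclideanSpace ℝ (Fin 2) ≃L[ℝ] EuclideanSpace ℝ (Fin 2))
    (hA : ∀ v w, metricRep (𝓡 2) (ofRiemannian h) p (extChartAt (𝓡 2) p p) v w = ⟪A v, A w⟫) :
    ∃ C r₀ : ℝ, 0 < r₀ ∧
      closedBall (extChartAt (𝓡 2) p p)
          (2 * r₀ * ‖((L.trans A).symm : EuclideanSpace ℝ (Fin 2) →L[ℝ] EuclideanSpace ℝ (Fin 2))‖)
        ⊆ (extChartAt (𝓡 2) p).target ∧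
      (∀ y ∈ (extChartAt (𝓡 2) p).source, extChartAt (𝓡 2) p y ∈ ball (extChartAt (𝓡 2) p p)
        (2 * r₀ * ‖((L.trans A).symm : EuclideanSpace ℝ (Fin 2) →L[ℝ] EuclideanSpace ℝ (Fin 2))‖)
        → y ≠ p → Y y ≠ 0) ∧
      ∀ r, 0 < r → r < r₀ →
        Continuous (fun y ↦ mvfderiv (𝓡 2) (mcutoff (𝓡 2) p
              ((L.trans A : EuclideanSpace ℝ (Fin 2) ≃L[ℝ] EuclideanSpace ℝ (Fin 2)) :
                EuclideanSpace ℝ (Fin 2) →L[ℝ] EuclideanSpace ℝ (Fin 2)) r) y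
            (normalizedAcceleration (ofRiemannian h) Y y)) ∧
        |(∫ y, mvfderiv (𝓡 2) (mcutoff (𝓡 2) p
              ((L.trans A : EuclideanSpace ℝ (Fin 2) ≃L[ℝ] EuclideanSpace ℝ (Fin 2)) :
                EuclideanSpace ℝ (Fin 2) →L[ℝ] EuclideanSpace ℝ (Fin 2)) r) y
            (normalizedAcceleration (ofRiemannian h) Y y) ∂riemannianMeasure h) +
          2 * π * (LinearMap.det (L : EuclideanSpace ℝ (Fin 2) →ₗ[ℝ] EuclideanSpace ℝ (Fin 2)) /
            |LinearMap.det (L : EuclideanSpace ℝ (Fin 2) →ₗ[ℝ] EuclideanSpace ℝ (Fin 2))|)|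
          ≤ C * r := by
  -- notation
  set g := ofRiemannian h with hg
  set φ := extChartAt (𝓡 2) p with hφ
  set c : EuclideanSpace ℝ (Fin 2) := φ p with hc
  set T : EuclideanSpace ℝ (Fin 2) ≃L[ℝ] EuclideanSpace ℝ (Fin 2) := L.trans A with hT
  set Ĝ := metricRep (𝓡 2) g p with hĜ
  set Ŷ := vectorRep (𝓡 2) p Y with hŶ
  set X := normalizedAcceleration g Y with hX
  set Xr := vectorRep (𝓡 2) p X with hXr
  set ρ : EuclideanSpace ℝ (Fin 2) → ℝ := fun e ↦ Real.sqrt (chartGramMatrix h p e).det with hρ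
  set dL : ℝ := LinearMap.det (L : EuclideanSpace ℝ (Fin 2) →ₗ[ℝ] EuclideanSpace ℝ (Fin 2))
    with hdL
  set dA : ℝ := LinearMap.det (A : EuclideanSpace ℝ (Fin 2) →ₗ[ℝ] EuclideanSpace ℝ (Fin 2))
    with hdA
  have h2 : Module.finrank ℝ (EuclideanSpace ℝ (Fin 2)) = 2 := finrank_euclideanSpace_fin
  have hct : c ∈ φ.target := mem_extChartAt_target p
  have hpc : φ.symm c = p := extChartAt_to_inv p
  have hTe : ∀ u, T u = A (L u) := fun u ↦ rfl
  -- the metric in the chart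
  have hĜm : IsMetricOn Ĝ φ.target :=
    OpensChart.isMetricOn_repr (val_chartPullback_eq_metricRep g p)
  have hA' : ∀ v w, Ĝ c v w = ⟪A v, A w⟫ := hA
  -- the field in the chart, and the remainder bound near the zero
  have hŶs : ContDiffOn ℝ ∞ Ŷ φ.target := contDiffOn_vectorRep p hY.contMDiffOn
  have hŶc : Ŷ c = 0 := by
    show mfderiv (𝓡 2) 𝓘(ℝ, EuclideanSpace ℝ (Fin 2)) φ (φ.symm c) (Y (φ.symm c)) = 0
    rw [hpc, hYp, map_zero]
  obtain ⟨δ, CR, hδ, hball, hq0, hXc, hR⟩ := hĜm.exists_remainder_bound hct h2 A hA' hŶs hŶc L hL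
  -- the density in the chart: smooth, hence Lipschitz near `c`, and `ρ c = |det A|`
  have hρs : ContDiffOn ℝ ∞ ρ φ.target := contDiffOn_sqrt_det_chartGramMatrix h p
  obtain ⟨Kρ, t, ht, hρt⟩ := ((hρs.contDiffAt ((isOpen_extChartAt_target p).mem_nhds hct)).of_le
    (by exact_mod_cast le_top)).exists_lipschitzOnWith
  obtain ⟨δ', hδ', hballt⟩ := Metric.mem_nhds_iff.1 ht
  have hρc_eq : ρ c = |dA| := by
    have hq : φ.symm c ∈ (chartAt (EuclideanSpace ℝ (Fin 2)) p).source := by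
      rw [hpc]; exact mem_chart_source _ p
    have hgram : ∀ i j, chartGramMatrix h p c i j =
        ⟪A (EuclideanSpace.basisFun (Fin 2) ℝ i), A (EuclideanSpace.basisFun (Fin 2) ℝ j)⟫ := by
      intro i j
      rw [← hA', hĜ, metricRep_apply_eq_val_symmL', hg, val_ofRiemannian,
        TangentBundle.symmL_trivializationAt hq, φ.right_inv hct]
      simp only [chartGramMatrix, Matrix.of_apply, EuclideanSpace.basisFun_apply]
      rfl
    have hmat : chartGramMatrix h p c = Matrix.of fun i j ↦
        ⟪(A : EuclideanSpace ℝ (Fin 2) →ₗ[ℝ] EuclideanSpace ℝ (Fin 2))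
          (EuclideanSpace.basisFun (Fin 2) ℝ i),
          (A : EuclideanSpace ℝ (Fin 2) →ₗ[ℝ] EuclideanSpace ℝ (Fin 2))
          (EuclideanSpace.basisFun (Fin 2) ℝ j)⟫ := by
      ext i j
      rw [hgram i j, Matrix.of_apply]
      rfl
    rw [hρ, hdA]
    dsimp only
    rw [hmat, sqrt_det_gram_eq_abs_det]
  -- a common radius
  set δ₁ : ℝ := min δ δ' with hδ₁
  have hδ₁pos : 0 < δ₁ := lt_min hδ hδ'
  have hb₁ : ball c δ₁ ⊆ ball c δ := ball_subset_ball (min_le_left _ _)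
  have hb₁' : ball c δ₁ ⊆ t := (ball_subset_ball (min_le_right _ _)).trans hballt
  have hb₁t : ball c δ₁ ⊆ φ.target := hb₁.trans hball
  -- hypotheses of the Euclidean flux lemma
  have hXreq : ∀ e ∈ φ.target, Xr e =
      (Ĝ e (Ŷ e) (Ŷ e))⁻¹ • (covDAt Ĝ Ŷ e (Ŷ e) - divAt Ĝ Ŷ e • Ŷ e) :=
    fun e he ↦ vectorRep_normalizedAcceleration g p hY.contMDiffOn ⟨e, he⟩
  have hXrc : ContinuousOn Xr (ball c δ₁ \ {c}) :=
    (hXc.mono (sdiff_subset_sdiff_left hb₁)).congr fun e he ↦ hXreq e (hb₁t he.1)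
  have hR' : ∀ e ∈ ball c δ₁ \ {c}, ‖Xr e - ((-dL) / ‖T (e - c)‖ ^ 2) • (e - c)‖ ≤ CR := by
    intro e he
    rw [hXreq e (hb₁t he.1), hTe]
    exact hR e (sdiff_subset_sdiff_left hb₁ he)
  have hρc' : ContinuousOn ρ (ball c δ₁) := hρs.continuousOn.mono hb₁t
  have hρL : ∀ e ∈ ball c δ₁, |ρ e - ρ c| ≤ Kρ * ‖e - c‖ := by
    intro e he
    have h1 := hρt.dist_le_mul e (hb₁' he) c (hb₁' (mem_ball_self hδ₁pos))
    rwa [Real.dist_eq, dist_eq_norm] at h1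
  obtain ⟨C, hC⟩ := abs_integral_fderiv_cutoff_sub_le h2 T c (-dL) hXrc hρc' hR' hρL
  -- the radius `r₀`
  set nT : ℝ := ‖(T.symm : EuclideanSpace ℝ (Fin 2) →L[ℝ] EuclideanSpace ℝ (Fin 2))‖ with hnT
  set r₀ : ℝ := δ₁ / (2 * (nT + 1)) with hr₀
  have hnT0 : 0 ≤ nT := norm_nonneg _
  have hr₀pos : 0 < r₀ := by positivity
  have hr₀δ : 2 * r₀ * nT < δ₁ := by
    rw [hr₀]
    have : 2 * (δ₁ / (2 * (nT + 1))) * nT = δ₁ * (nT / (nT + 1)) := by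
      field_simp
    rw [this]
    have h1 : nT / (nT + 1) < 1 := by rw [div_lt_one (by positivity)]; linarith
    calc δ₁ * (nT / (nT + 1)) < δ₁ * 1 := mul_lt_mul_of_pos_left h1 hδ₁pos
      _ = δ₁ := mul_one _
  have hclosed₀ : closedBall c (2 * r₀ * nT) ⊆ ball c δ₁ :=
    closedBall_subset_ball hr₀δ
  refine ⟨C, r₀, hr₀pos, hclosed₀.trans hb₁t, ?_, fun r hr hrr₀ ↦ ?_⟩
  · -- no other zero of `Y` in the ball
    intro y hy hyb hyp hYy
    have he : φ y ∈ ball c δ \ {c} := by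
      refine ⟨hb₁ (ball_subset_ball hr₀δ.le hyb), fun he ↦ hyp ?_⟩
      have := congrArg φ.symm (show φ y = c from he)
      rwa [φ.left_inv hy, hpc] at this
    apply hq0 (φ y) he
    have hŶy : Ŷ (φ y) = 0 := by
      show mfderiv (𝓡 2) 𝓘(ℝ, EuclideanSpace ℝ (Fin 2)) φ (φ.symm (φ y)) (Y (φ.symm (φ y))) = 0
      rw [φ.left_inv hy, hYy, map_zero]
    simp [hŶy]
  -- the main estimate, for `0 < r < r₀`
  have hrr' : 2 * r * nT ≤ 2 * r₀ * nT := mul_le_mul_of_nonneg_right (by linarith) hnT0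
  have hrδ : 2 * r * nT < δ₁ := lt_of_le_of_lt hrr' hr₀δ
  have hclosed : closedBall c (2 * r * nT) ⊆ φ.target :=
    ((closedBall_subset_closedBall hrr').trans hclosed₀).trans hb₁t
  -- the integrand and its chart representative
  set D := fderiv ℝ (cutoff (T : EuclideanSpace ℝ (Fin 2) →L[ℝ] EuclideanSpace ℝ (Fin 2)) c r)
    with hD
  set F : EuclideanSpace ℝ (Fin 2) → ℝ := fun e ↦ D e (Xr e) with hF
  set u : N → ℝ := fun y ↦ mvfderiv (𝓡 2) (mcutoff (𝓡 2) p
    (T : EuclideanSpace ℝ (Fin 2) →L[ℝ] EuclideanSpace ℝ (Fin 2)) r) y (X y) with hu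
  have hFc : Continuous F := continuous_fderiv_cutoff_apply T hr hrδ hXrc
  have huF : ∀ y ∈ φ.source, u y = F (φ y) := by
    intro y hy
    simp only [hu, hF, hD]
    rw [mvfderiv_mcutoff_apply p _ r hy]
    congr 1
    show _ = mfderiv (𝓡 2) 𝓘(ℝ, EuclideanSpace ℝ (Fin 2)) φ (φ.symm (φ y)) (X (φ.symm (φ y)))
    rw [φ.left_inv hy]
  have hu0 : ∀ y, y ∉ mcutoffSupport (𝓡 2) p T r → u y = 0 := by
    intro y hy
    simp only [hu]
    rw [mvfderiv_mcutoff_eq_zero p T hr hclosed hy, _root_.zero_apply]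
  have husupp : support u ⊆ φ.source := by
    intro y hy
    by_contra hys
    exact hy (hu0 y fun h' ↦ hys (mcutoffSupport_subset_source p T hclosed h'))
  have hucont : Continuous u := by
    rw [continuous_iff_continuousAt]
    intro y
    by_cases hys : y ∈ φ.source
    · have h1 : ContinuousAt (F ∘ φ) y :=
        hFc.continuousAt.comp (continuousAt_extChartAt' hys)
      refine h1.congr ?_
      filter_upwards [(isOpen_extChartAt_source (I := 𝓡 2) p).mem_nhds hys] with z hz
      exact (huF z hz).symm
    · have hy : y ∉ mcutoffSupport (𝓡 2) p T r :=
        fun h' ↦ hys (mcutoffSupport_subset_source p T hclosed h')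
      refine (continuousAt_const (y := (0 : ℝ))).congr ?_
      filter_upwards [(isCompact_mcutoffSupport p T hclosed).isClosed.isOpen_compl.mem_nhds hy]
        with z hz
      exact (hu0 z hz).symm
  -- change of variables to the chart
  have hF0 : ∀ e, e ∉ φ.target → F e = 0 := by
    intro e he
    simp only [hF]
    by_cases hDe : D e = 0
    · rw [hDe, _root_.zero_apply]
    · exact absurd (hclosed (mem_closedBall_of_fderiv_cutoff_ne_zero T hr hDe)) he
  have hint : ∫ y, u y ∂riemannianMeasure h = ∫ e, F e * ρ e := by
    rw [integral_eq_integral_chart h p hucont.measurable husupp]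
    have h1 : ∫ e in φ.target, ρ e • u (φ.symm e) = ∫ e in φ.target, F e * ρ e := by
      refine setIntegral_congr_fun (measurableSet_extChartAt_target p) fun e he ↦ ?_
      simp only [smul_eq_mul]
      rw [huF _ (φ.map_target he), φ.right_inv he, mul_comm]
    rw [h1]
    exact setIntegral_eq_integral_of_forall_compl_eq_zero fun e he ↦ by rw [hF0 e he, zero_mul]
  -- the value of the principal term
  have hdL0 : dL ≠ 0 := (LinearEquiv.isUnit_det' L.toLinearEquiv).ne_zero
  have hdA0 : dA ≠ 0 := (LinearEquiv.isUnit_det' A.toLinearEquiv).ne_zero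
  have hdetT : LinearMap.det (T : EuclideanSpace ℝ (Fin 2) →ₗ[ℝ] EuclideanSpace ℝ (Fin 2)) =
      dA * dL := by
    rw [hdA, hdL, ← LinearMap.det_comp]
    congr 1
  have hconst : 2 * π * (-dL) * ρ c /
      |LinearMap.det (T : EuclideanSpace ℝ (Fin 2) →ₗ[ℝ] EuclideanSpace ℝ (Fin 2))| =
      -(2 * π * (dL / |dL|)) := by
    rw [hdetT, hρc_eq, abs_mul]
    have : |dA| ≠ 0 := abs_ne_zero.2 hdA0
    field_simp
  have hmain := hC r hr hrδ
  rw [hconst, sub_neg_eq_add, Real.norm_eq_abs] at hmain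
  refine ⟨hucont, ?_⟩
  show |(∫ y, u y ∂riemannianMeasure h) + 2 * π * (dL / |dL|)| ≤ C * r
  rwa [hint]

omit [(ofRiemannian h).HasLeviCivita] in
/-- **The measure of the cutoff region is `O(r²)`.** If the density `√det(h_{ij})` is bounded by
`B` on `closedBall (φ p) R ⊆ φ.target` and `2 r ‖T⁻¹‖ ≤ R`, then
`μ_h(mcutoffSupport p T r) ≤ B · π (2 r ‖T⁻¹‖)²` (chart formula for the Riemannian measure,
`integral_eq_integral_chart`, and the area of a Euclidean disc). [folklore] -/
theorem measureReal_mcutoffSupport_le (p : N)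
    (T : EuclideanSpace ℝ (Fin 2) ≃L[ℝ] EuclideanSpace ℝ (Fin 2)) {r R B : ℝ} (hr : 0 ≤ r)
    (hrR : 2 * r * ‖(T.symm : EuclideanSpace ℝ (Fin 2) →L[ℝ] EuclideanSpace ℝ (Fin 2))‖ ≤ R)
    (hR : closedBall (extChartAt (𝓡 2) p p) R ⊆ (extChartAt (𝓡 2) p).target)
    (hB : ∀ e ∈ closedBall (extChartAt (𝓡 2) p p) R,
      Real.sqrt (chartGramMatrix h p e).det ≤ B) :
    (riemannianMeasure h).real (mcutoffSupport (𝓡 2) p T r) ≤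
      B * (π * (2 * r * ‖(T.symm : EuclideanSpace ℝ (Fin 2) →L[ℝ] EuclideanSpace ℝ (Fin 2))‖)
        ^ 2) := by
  set φ := extChartAt (𝓡 2) p with hφ
  set c : EuclideanSpace ℝ (Fin 2) := φ p with hc
  set nT : ℝ := ‖(T.symm : EuclideanSpace ℝ (Fin 2) →L[ℝ] EuclideanSpace ℝ (Fin 2))‖ with hnT
  set K := mcutoffSupport (𝓡 2) p T r with hK
  set D := closedBall c (2 * r * nT) with hD
  have h2 : Module.finrank ℝ (EuclideanSpace ℝ (Fin 2)) = 2 := finrank_euclideanSpace_fin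
  have hDR : D ⊆ closedBall c R := closedBall_subset_closedBall hrR
  have hDt : D ⊆ φ.target := hDR.trans hR
  have hKc : IsCompact K := isCompact_mcutoffSupport p T hDt
  have hKm : MeasurableSet K := hKc.isClosed.measurableSet
  have hKs : K ⊆ φ.source := mcutoffSupport_subset_source p T hDt
  -- `μ(K) = ∫ 1_K dμ = ∫_{target} ρ • 1_K ∘ φ⁻¹ = ∫_D ρ`
  have h1 : (riemannianMeasure h).real K = ∫ y, K.indicator (fun _ ↦ (1 : ℝ)) y ∂riemannianMeasure h :=
    (integral_indicator_one hKm).symm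
  have hmeas : Measurable (K.indicator fun _ ↦ (1 : ℝ)) := measurable_const.indicator hKm
  have hsupp : support (K.indicator fun _ ↦ (1 : ℝ)) ⊆ φ.source :=
    (support_indicator_subset).trans hKs
  have hind : ∀ e ∈ φ.target, K.indicator (fun _ ↦ (1 : ℝ)) (φ.symm e) = D.indicator (fun _ ↦ 1) e := by
    intro e he
    by_cases heD : e ∈ D
    · rw [indicator_of_mem heD, indicator_of_mem]
      exact ⟨e, heD, rfl⟩
    · rw [indicator_of_notMem heD, indicator_of_notMem]
      rintro ⟨e', he', hee'⟩
      exact heD ((φ.symm.injOn (hDt he') he hee') ▸ he')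
  have h3 : ∫ e in φ.target, Real.sqrt (chartGramMatrix h p e).det • K.indicator (fun _ ↦ (1 : ℝ))
      (φ.symm e) = ∫ e in D, Real.sqrt (chartGramMatrix h p e).det := by
    have : ∫ e in φ.target, Real.sqrt (chartGramMatrix h p e).det • K.indicator (fun _ ↦ (1 : ℝ))
        (φ.symm e) = ∫ e in φ.target, D.indicator (fun e ↦ Real.sqrt (chartGramMatrix h p e).det) e := by
      refine setIntegral_congr_fun (measurableSet_extChartAt_target p) fun e he ↦ ?_
      rw [hind e he, smul_eq_mul]
      by_cases heD : e ∈ D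
      · rw [indicator_of_mem heD, indicator_of_mem heD, mul_one]
      · rw [indicator_of_notMem heD, indicator_of_notMem heD, mul_zero]
    rw [this, setIntegral_indicator measurableSet_closedBall, inter_eq_self_of_subset_right hDt]
  rw [h1, integral_eq_integral_chart h p hmeas hsupp, h3]
  -- `∫_D ρ ≤ B vol(D)`
  have hvol : (volume : Measure (EuclideanSpace ℝ (Fin 2))).real D = π * (2 * r * nT) ^ 2 :=
    volume_real_closedBall_of_finrank_eq_two h2 c (by positivity)
  have hbound : ‖∫ e in D, Real.sqrt (chartGramMatrix h p e).det‖ ≤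
      B * (volume : Measure (EuclideanSpace ℝ (Fin 2))).real D := by
    refine norm_setIntegral_le_of_norm_le_const measure_closedBall_lt_top fun e he ↦ ?_
    rw [Real.norm_eq_abs, abs_of_nonneg (Real.sqrt_nonneg _)]
    exact hB e (hDR he)
  rw [hvol] at hbound
  exact (le_abs_self _).trans ((Real.norm_eq_abs _) ▸ hbound)

end Flux

end Literature.Geometry.Riemannian

end
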